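/-
Copyright (c) 2026 Gabriel Dahia. All rights reserved.
Released under Apache 2.0 license as described in the file LICENSE.
Authors: Gabriel Dahia

Ported into this library from `DensityHalesJewett/Canonization.lean` of
github.com/gdahia/DensityHalesJewett @ 27e0e64 (Apache-2.0): the namespace `DensityHalesJewett`
becomes `Literature.Combinatorics.HalesJewett`, module names are flattened and docstrings
carry provenance tags; the mathematics is unchanged.
-/
import Literature.Combinatorics.HalesJewett.SubspaceToolkit
import Mathlib.Data.Finite.Prod
import Mathlib.Data.Finite.Sum
import HarnessLib

/-!
# Canonization of the constant letters

A word over the alphabet `Option α` is a word over `α` with variable positions marked by `none`;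
its support is the set of variable positions.  Substituting such a word into a combinatorial
subspace is the toolkit's action on variable words `V.pat` (`SubspaceToolkit.lean`:
`Combinatorics.Subspace.pat`, with `comp_pat` and `line_idxFun`; the upstream port's own
`wordMap`, definitionally equal to `pat`, was deleted in its favour), which turns a subspace of
dimension `ℓ` into a map from words of length `ℓ` to words of length the ambient dimension.

The main result `exists_canonical` is the support canonization lemma of the standard derivation
of the Graham--Rothschild theorem for lines from the Hales--Jewett theorem (compare the inductive
construction in Prömel 2013, proof of Thm 5.1): after passing to a suitable `ℓ`-dimensional
subspace, the
colour of a substituted word depends only on its support.  It is proved by induction on `ℓ`, one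
application of the ordinary Hales--Jewett theorem per variable, each of them applied to the
profile of colours obtained by letting the remaining positions vary.

## Source of the formalization

This file is a port (namespace, imports and docstring tags only; proofs unchanged) of the file
`DensityHalesJewett/Canonization.lean`
of the Apache-2.0 Lean 4 development github.com/gdahia/DensityHalesJewett @ 27e0e64 (G. Dahia 2026),
a formalization of Dodos–Kanellopoulos–Tyros, *A simple proof of the density Hales–Jewett
theorem* (IMRN 2014).
Paper locators in the tags refer to that article (arXiv:1209.4986 numbering: Thm 1, Prop. 2–3,
Lemma 4, Cor. 5, Prop. 6, Lemmas 7–8, Def. 9, Lemma 10, Cor. 11, Lemma 12, Cor. 13).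
Status (2026-08-15): of this port the tree holds `Word`, `Subspace`, `FiniteUnions`, `Canonization`,
`GrahamRothschild` and `Insensitive` (this directory). The density Hales–Jewett theorem itself was
completed in the tree by the parallel development `DKTSubspaces` / `DKTCorrelation` /
`DensityHalesJewettProofs` (`DensityHalesJewett_holds`; it builds on `Word.lean` and `Subspace.lean`
of this port), and Szemerédi's theorem is discharged as
`Literature.Combinatorics.Additive.SzemerediTheorem_holds` in
`NumberTheory/Sieve/ParityWave0GreenTaoHolds.lean`; the remaining upstream files (`UniformFibers`,
the tilings of `Insensitive`, `DensityIncrement/…`, `Main`) were therefore not ported.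

## References
* P. Dodos, V. Kanellopoulos, K. Tyros, *A simple proof of the density Hales–Jewett theorem*,
  IMRN 2014 (12), 3340–3352, arXiv:1209.4986. [cite: DodosKanellopoulosTyros2014]
* H. Furstenberg, Y. Katznelson, *A density version of the Hales–Jewett theorem*, J. Anal. Math. 57
  (1991), 64–119 — the theorem. [cite: FurstenbergKatznelson1991]
* D. H. J. Polymath, *A new proof of the density Hales–Jewett theorem*, Ann. of Math. 175 (2012),
  1283–1327. [cite: Polymath2012DHJ]
* H. J. Prömel, *Ramsey Theory for Discrete Structures*, Springer 2013, Thm 5.1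
  (Graham–Rothschild), Thm 5.7 (finite union theorem). [cite: Promel2013]
-/

open Finset
open Combinatorics

namespace Literature.Combinatorics.HalesJewett

/-- Two words over `Option α` have the same support when their variable positions agree.
[folklore] -/
def SameSupport {α ι : Type*} (x y : ι → Option α) : Prop := ∀ i, x i = none ↔ y i = none

namespace Line

variable {α ι : Type*}

/-- The word obtained from a line by substituting a letter, or the variable itself, at its
variable positions. [folklore] -/
def fillOption (l : Combinatorics.Line α ι) (v : Option α) : ι → Option α :=
  fun i ↦ (l.idxFun i).elim v some

/-- Filling the variable positions of a line with a letter `a` gives the word `l a` (read in `Option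
α`). [folklore] -/
@[simp]
lemma fillOption_some (l : Combinatorics.Line α ι) (a : α) :
    fillOption l (some a) = some ∘ l a := by
  funext i
  cases h : l.idxFun i <;> simp [fillOption, Combinatorics.Line.coe_apply, h]

end Line

namespace Subspace

variable {α η θ ι : Type*}

/-- Prepend a new variable direction, realized by a line on a fresh block of coordinates, to the
directions of a subspace. [folklore] -/
def consLine {ℓ : ℕ} {B B' : Type*} (V : Combinatorics.Subspace (Fin ℓ) α B)
    (l : Combinatorics.Line α B') : Combinatorics.Subspace (Fin (ℓ + 1)) α (B ⊕ B') where
  idxFun := Sum.elim (fun b ↦ (V.idxFun b).map id Fin.succ)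
    fun i ↦ (l.idxFun i).elim (Sum.inr 0) Sum.inl
  proper e := by
    induction e using Fin.cases with
    | zero =>
      obtain ⟨i, hi⟩ := l.proper
      exact ⟨Sum.inr i, by simp [hi]⟩
    | succ j =>
      obtain ⟨b, hb⟩ := V.proper j
      exact ⟨Sum.inl b, by simp [hb]⟩

/-- Substituting into `consLine V l` acts as `V` on the old block and fills the line `l` on the
fresh block with the new first letter. [folklore] -/
lemma pat_consLine {ℓ : ℕ} {B B' : Type*} (V : Combinatorics.Subspace (Fin ℓ) α B)
    (l : Combinatorics.Line α B') (x : Fin (ℓ + 1) → Option α) :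
    (consLine V l).pat x
      = Sum.elim (V.pat fun i ↦ x i.succ) (Line.fillOption l (x 0)) := by
  funext i
  cases i with
  | inl b => cases h : V.idxFun b <;> simp [Combinatorics.Subspace.pat, consLine, h]
  | inr i =>
    cases h : l.idxFun i <;> simp [Combinatorics.Subspace.pat, consLine, Line.fillOption, h]

/-- Embed the first `N` coordinates of a cube into a larger one, filling the remaining
coordinates with a fixed letter (a concrete instance of padding; compare the toolkit's
`Combinatorics.Subspace.extend` along an embedding, which is not used here). [folklore] -/
noncomputable def padInitial (α : Type*) [Nonempty α] {N n : ℕ} (h : N ≤ n) :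
    Combinatorics.Subspace (Fin N) α (Fin n) where
  idxFun i := if hi : i.val < N then Sum.inr ⟨i.val, hi⟩ else Sum.inl (Classical.arbitrary α)
  proper e := ⟨Fin.castLE h e, by simp [Fin.castLE, e.isLt]⟩

end Subspace

namespace Canonization

variable {α : Type*}

open Subspace

/-- The inductive form of support canonization: for any block of positions preceding the
variables and any block of variable slots following them, there is a block of positions carrying
`ℓ` variables on which every colouring becomes a function of the support alone. [folklore] -/
private lemma exists_canonical_aux (α : Type*) [Finite α] (C : Type*) [Finite C] (ℓ : ℕ) :
    ∀ (P S : Type) [Finite P] [Finite S], ∃ (B : Type) (_ : Finite B),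
      ∀ χ : (P → Option α) → (B → Option α) → (S → Option α) → C,
        ∃ V : Combinatorics.Subspace (Fin ℓ) α B,
          ∀ (p : P → Option α) (s : S → Option α) (x y : Fin ℓ → Option α),
            SameSupport x y → χ p (V.pat x) s = χ p (V.pat y) s := by
  induction ℓ with
  | zero =>
    intro P S _ _
    refine ⟨PEmpty, inferInstance, ?_⟩
    intro χ
    refine ⟨⟨PEmpty.elim, ?_⟩, ?_⟩
    · intro e
      exact e.elim0
    · intro p s _ _ _
      exact congrArg (fun w ↦ χ p w s) (funext fun i ↦ i.elim)
  | succ ℓ ih =>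
    intro P S _ _
    obtain ⟨B, _, hB⟩ := ih P (Unit ⊕ S)
    obtain ⟨B', _, hB'⟩ := Combinatorics.Line.exists_mono_in_high_dimension α
      ((P → Option α) → (B → Option α) → (S → Option α) → C)
    refine ⟨B ⊕ B', inferInstance, ?_⟩
    intro χ
    obtain ⟨l, prof, hprof⟩ := hB' fun u p b s ↦ χ p (Sum.elim b (some ∘ u)) s
    have hprof' : ∀ (a : α) (p : P → Option α) (b : B → Option α) (s : S → Option α),
        χ p (Sum.elim b (some ∘ l a)) s = prof p b s :=
      fun a p b s ↦ congrFun (congrFun (congrFun (hprof a) p) b) s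
    obtain ⟨V, hV⟩ := hB fun p b q ↦
      χ p (Sum.elim b (Line.fillOption l (q (Sum.inl ())))) fun s ↦ q (Sum.inr s)
    refine ⟨consLine V l, ?_⟩
    intro p s x y hxy
    rw [pat_consLine, pat_consLine]
    apply Eq.trans (hV p (Sum.elim (fun _ ↦ x 0) s) (fun i ↦ x i.succ) (fun i ↦ y i.succ)
      fun i ↦ hxy i.succ)
    simp only [Sum.elim_inl, Sum.elim_inr]
    cases hx : x 0 with
    | none => rw [(hxy 0).1 hx]
    | some a =>
      cases hy : y 0 with
      | none => simp [(hxy 0).2 hy] at hx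
      | some b =>
        rw [Line.fillOption_some, Line.fillOption_some, hprof' a, hprof' b]

/-- **Support canonization**: in a large enough cube every colouring of words over `Option α`
admits an `ℓ`-dimensional subspace on which the colour of a substituted word depends only on its
support. [folklore] -/
lemma exists_canonical (α : Type*) [Finite α] (C : Type*) [Finite C] (ℓ : ℕ) :
    ∃ N : ℕ, ∀ χ : (Fin N → Option α) → C,
      ∃ V : Combinatorics.Subspace (Fin ℓ) α (Fin N),
        ∀ x y : Fin ℓ → Option α, SameSupport x y → χ (V.pat x) = χ (V.pat y) := by
  obtain ⟨B, _, hB⟩ := exists_canonical_aux α C ℓ PEmpty PEmpty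
  have := Fintype.ofFinite B
  refine ⟨Fintype.card B, ?_⟩
  intro χ
  obtain ⟨V, hV⟩ := hB fun _ w _ ↦ χ (w ∘ (Fintype.equivFin B).symm)
  have hw (z : Fin ℓ → Option α) :
      (V.reindex (Equiv.refl _) (Equiv.refl _) (Fintype.equivFin B)).pat z
        = V.pat z ∘ (Fintype.equivFin B).symm := by
    funext i
    cases h : V.idxFun ((Fintype.equivFin B).symm i) <;>
      simp [Combinatorics.Subspace.pat, Combinatorics.Subspace.reindex, h]
  refine ⟨V.reindex (Equiv.refl _) (Equiv.refl _) (Fintype.equivFin B), ?_⟩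
  intro x y hxy
  rw [hw x, hw y]
  exact hV PEmpty.elim PEmpty.elim x y hxy

/-- Support canonization holds in every ambient dimension beyond the one it produces. [folklore] -/
lemma exists_canonical_of_le (α : Type*) [Finite α] [Nonempty α] (C : Type*) [Finite C] (ℓ : ℕ) :
    ∃ N : ℕ, ∀ n, N ≤ n → ∀ χ : (Fin n → Option α) → C,
      ∃ V : Combinatorics.Subspace (Fin ℓ) α (Fin n),
        ∀ x y : Fin ℓ → Option α, SameSupport x y → χ (V.pat x) = χ (V.pat y) := by
  obtain ⟨N, hN⟩ := exists_canonical α C ℓ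
  refine ⟨N, ?_⟩
  intro n hn χ
  obtain ⟨V, hV⟩ := hN fun w ↦ χ ((padInitial α hn).pat w)
  refine ⟨(padInitial α hn).comp V, ?_⟩
  intro x y hxy
  rw [Combinatorics.Subspace.comp_pat, Combinatorics.Subspace.comp_pat]
  exact hV x y hxy

end Canonization
end Literature.Combinatorics.HalesJewett
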